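import Summits.BirchSwinnertonDyer.Rank1Residual.X11b.Three.ImageSah
import Mathlib.Tactic
import HarnessLib

/-!
# X11b at `p = 3` (team N8/O2, S7 / LINE-K K4(a), consumer layer): on a `3^m`-torsion module an
# automorphism that is `−1` on the `3`-torsion has `3^{m−1}`-th power `−1` — basis-free lift, Sah
# for the image group (cell `b2b-bsdres`, team `x11b3`, seat p7)

HONEST FRAMING (verbatim, cell `b2b-bsdres`, run/shared/lean/b2b/bsd-rank1-residual/): the goal of
the cell is to DELETE the COMBINATION-SHAPED residual classes for ALL analytic-rank `≤ 1` curves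
over `ℚ` — "full BSD formula for every rank `≤ 1` curve in class `C`" assembled STRICTLY from
published theorems — so that the rank-`≤ 1` remainder becomes exactly the CONSTRUCTION-SHAPED
classes, which are TYPED (missing-input Props), NOT attempted; this is not "finishing BSD".
Research route (team N8/O2: STEP L at `3 ‖ N`); PURE ALGEBRA; nothing booked; no label touched;
X11b@3 stays OPEN (RESIDUAL-MAP §I O2). THEOREMS ONLY; no definition; no named fact; no `sorry`.

## Why (LEAD DEAL #3: "the n1011 consumer shape `Surj W 3 → ∀ m, H¹(Gal(ℚ(E[3^m])/ℚ), E[3^m]) = 0`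
## as p7's append"; team n1011 R3-20; LINE-K K4(a))

p1's `Three/ImageNegOneLift.lean` lifts `−1` from `GL₂(𝔽₃)` to `GL₂(ℤ/3^m)` for MATRIX groups
(`h ≡ −1 (mod 3) ⇒ h^{3^{m−1}} = −1`). The tree's mod-`n` Galois representation
(`WeierstrassCurve.galoisRepTorsion W n : Γ_F →* Aut(E[n])`, `GaloisAction.lean`) is NOT a matrix
representation — `E[n] = E(F̄)[n]` carries no basis — so the consumer form needs the lift on an
ABSTRACT `3^m`-torsion abelian group `M` (think `M = E[3^m]`, `M[3] = E[3]`):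

* §1 `TorsionLift.pow_three_pow_apply_eq_self` — for an additive endomorphism `τ` of `M` with
  `τ = id` on `M[3]`: `τ^{3^k} = id` on `M[3^{k+1}]` (induction: with `φ = τ^{3^k}` and `d = φx − x`
  one has `3d = 0` and `φ d = d` on `M[3^{k+2}]`, so `φ³ x = x + 3d = x`);
  `TorsionLift.pow_three_pow_apply_eq_neg` — `σ = −1` on `M[3]`, `3^m M = 0`, `m ≥ 1` ⇒
  `σ^{3^{m−1}} = −1` on `M` (apply §1 to `τ = −σ`; `3^{m−1}` is odd). NO basis, NO freeness of `M`.
* §2 group actions: `Γ` acting on `M` (`DistribMulAction`), `3^m M = 0`, some `γ₀` acting as `−1` on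
  `M[3]` ⇒ `γ₀^{3^{m−1}}` acts as `−1` on `M` (`smul_pow_three_pow_eq_neg`), hence NO non-zero
  `Γ`-fixed vector (`eq_zero_of_forall_smul_eq`).
* §3 Sah for the IMAGE group: for a subgroup `G ≤ AddAut M` containing an element acting as `−1`
  with `3^m M = 0`: every crossed homomorphism `f : G → M` (`f(gh) = g(f h) + f g`) is principal
  (`AddAut.exists_eq_sub_of_crossedHom`) and `M` has no non-zero `G`-fixed vector — i.e.
  "`H¹(Gal(F(E[3^m])/F), E[3^m]) = 0` and `E[3^m]^{Gal} = 0`" once `Gal(F(E[3^m])/F)` is identified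
  with the image of `Γ_F` in `Aut(E[3^m])` (Galois glue: companion `Three/GaloisImageNegOne.lean`).
  Direct Sah computation with an element acting as the CENTRAL automorphism `−1`; `2` is invertible
  on a `3^m`-torsion group.

What this is NOT: no elliptic curve here (companion file); nothing about WHICH groups contain `−1`
beyond the lift; elementary; nothing booked.

References: C.-H. Sah, J. Algebra 10 (1968) Prop. 2.7 (b) [Sah1968]; T. Lawson, C. Wuthrich,
*Vanishing of some Galois cohomology groups for elliptic curves*, in Elliptic curves, modular
forms and Iwasawa theory, Springer PROMS 188 (2016), Lemma 3 (the lift `−I ∈ im ρ̄₃ ⇒ −I ∈ im ρ_{3^i}`)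
[LawsonWuthrich2016]; team files `cells/x11b3/PLAN.md` §2 S7, `cells/x11b3/LINE-K.md` K4(a),
LEAD DEAL #3 (OWNERS.md ⟦05:40Z⟧).
-/

namespace Summit.BirchSwinnertonDyer.Rank1Residual.X11b.Three

namespace TorsionLift

variable {M : Type*} [AddCommGroup M]

/-! ### §0. Arithmetic on a `3^m`-torsion group: `3·d = 0 ⇒ d + d + d = 0`; `2` is invertible -/

/-- `3 • d = d + d + d`. [folklore] -/
theorem three_nsmul_eq (d : M) : (3 : ℕ) • d = d + d + d := by
  rw [show (3 : ℕ) = 2 + 1 from rfl, add_nsmul, two_nsmul, one_nsmul]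

/-- On a group killed by an odd number, `2x = 0` forces `x = 0`. [folklore] -/
theorem eq_zero_of_two_nsmul_eq_zero_of_odd_nsmul_eq_zero {n : ℕ} (hn : Odd n) {x : M}
    (hnx : n • x = 0) (h2x : (2 : ℕ) • x = 0) : x = 0 := by
  obtain ⟨k, rfl⟩ := hn
  rw [add_nsmul, one_nsmul, mul_nsmul, h2x, smul_zero, zero_add] at hnx
  exact hnx

/-- On a group killed by an odd number `n`, doubling is a bijection (`2·((k+1)x) = x` for
`n = 2k+1`). [folklore] -/
theorem bijective_two_nsmul_of_odd_nsmul_eq_zero {n : ℕ} (hn : Odd n) (hM : ∀ x : M, n • x = 0) :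
    Function.Bijective fun x : M => (2 : ℕ) • x := by
  obtain ⟨k, hk⟩ := hn
  refine ⟨fun x y hxy => ?_, fun y => ⟨(k + 1) • y, ?_⟩⟩
  · have h : (2 : ℕ) • (x - y) = 0 := by
      simp only [smul_sub, sub_eq_zero]; exact hxy
    exact sub_eq_zero.mp (eq_zero_of_two_nsmul_eq_zero_of_odd_nsmul_eq_zero ⟨k, hk⟩ (hM _) h)
  · show (2 : ℕ) • (k + 1) • y = y
    rw [smul_smul, show 2 * (k + 1) = n + 1 by omega, add_nsmul, hM y, one_nsmul, zero_add]

/-! ### §1. The basis-free lift in `AddMonoid.End M` -/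

/-- Unfolding powers of an additive endomorphism: `(φ ^ 3) x = φ (φ (φ x))`. [folklore] -/
theorem pow_three_apply (φ : AddMonoid.End M) (x : M) : (φ ^ 3) x = φ (φ (φ x)) := by
  rw [AddMonoid.End.coe_pow]
  rfl

/-- **Core induction.** If an additive endomorphism `τ` of `M` fixes every `x` with `3x = 0`, then
`τ^{3^k}` fixes every `x` with `3^{k+1} x = 0`. Step: for `φ = τ^{3^k}` and `x ∈ M[3^{k+2}]`, the
element `d = φ x − x` satisfies `3d = φ(3x) − 3x = 0` (as `3x ∈ M[3^{k+1}]`), hence `φ d = d`, and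
`φ³ x = x + 3d = x`. [folklore] -/
theorem pow_three_pow_apply_eq_self (τ : AddMonoid.End M)
    (hτ : ∀ x : M, (3 : ℕ) • x = 0 → τ x = x) :
    ∀ (k : ℕ) (x : M), (3 : ℕ) ^ (k + 1) • x = 0 → (τ ^ 3 ^ k) x = x := by
  intro k
  induction k with
  | zero =>
    intro x hx
    rw [pow_zero, pow_one]
    exact hτ x (by rwa [zero_add, pow_one] at hx)
  | succ k ih =>
    intro x hx
    have hpow : τ ^ 3 ^ (k + 1) = (τ ^ 3 ^ k) ^ 3 := by rw [← pow_mul, ← pow_succ]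
    set φ : AddMonoid.End M := τ ^ 3 ^ k with hφ
    -- `3x ∈ M[3^{k+1}]`, so `φ (3x) = 3x`
    have h3x : φ ((3 : ℕ) • x) = (3 : ℕ) • x := by
      refine ih _ ?_
      rw [smul_smul, ← pow_succ]
      exact hx
    set d : M := φ x - x with hd
    have h3d : (3 : ℕ) • d = 0 := by
      rw [hd, smul_sub, ← map_nsmul, h3x, sub_self]
    have hddd : d + d + d = 0 := by rw [← three_nsmul_eq]; exact h3d
    have hφd : φ d = d := by
      refine ih d ?_
      rw [pow_succ, mul_smul, h3d, smul_zero]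
    have hφx : φ x = x + d := by rw [hd]; abel
    rw [hpow, pow_three_apply, hφx, map_add, hφx, hφd, map_add, map_add, hφx, hφd]
    calc x + d + d + d = x + (d + d + d) := by abel
      _ = x := by rw [hddd, add_zero]

/-- **The lift, endomorphism form.** Let `3^m M = 0` with `m ≥ 1` and let `σ` be an additive
endomorphism of `M` acting as `−1` on `M[3]` (`σ x = −x` whenever `3x = 0`). Then `σ^{3^{m−1}}`
acts as `−1` on all of `M` (apply the core induction to `τ = −σ`; `3^{m−1}` is odd). For
`M = E[3^m]`: an element of `Gal` that is `−1` on `E[3]` has a power that is `−1` on `E[3^m]` — the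
basis-free form of Lawson–Wuthrich's Lemma 3 / p1's `ImageNegOneLift`.
[cite: LawsonWuthrich2016, Lemma 3] -/
theorem pow_three_pow_apply_eq_neg (σ : AddMonoid.End M) {m : ℕ} (hm : 1 ≤ m)
    (hM : ∀ x : M, (3 : ℕ) ^ m • x = 0) (hσ : ∀ x : M, (3 : ℕ) • x = 0 → σ x = -x) (x : M) :
    (σ ^ 3 ^ (m - 1)) x = -x := by
  set τ : AddMonoid.End M := -σ with hτdef
  have hτapp : ∀ y : M, τ y = -σ y := fun y ↦ rfl
  have hτ : ∀ y : M, (3 : ℕ) • y = 0 → τ y = y := fun y hy ↦ by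
    rw [hτapp, hσ y hy, neg_neg]
  have key := pow_three_pow_apply_eq_self τ hτ (m - 1) x
    (by rw [Nat.sub_add_cancel hm]; exact hM x)
  have hodd : Odd (3 ^ (m - 1)) := Odd.pow (by decide)
  have hστ : σ = -τ := by rw [hτdef, neg_neg]
  rw [hστ, hodd.neg_pow]
  show -((τ ^ 3 ^ (m - 1)) x) = -x
  rw [key]

end TorsionLift

/-! ### §2. Group actions: an element acting as `−1` on `M[3]` has a power acting as `−1` on `M` -/

section Action

variable {Γ M : Type*} [Group Γ] [AddCommGroup M] [DistribMulAction Γ M]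

/-- **Lift for a group action.** If `3^m M = 0` (`m ≥ 1`) and `γ₀ ∈ Γ` acts as `−1` on `M[3]`, then
`γ₀^{3^{m−1}}` acts as `−1` on `M`. (For `Γ = Γ_F`, `M = E[3^m]`: surjectivity of `ρ̄_{E,3}` supplies
`γ₀`.) [cite: LawsonWuthrich2016, Lemma 3] -/
theorem smul_pow_three_pow_eq_neg {m : ℕ} (hm : 1 ≤ m) (hM : ∀ x : M, (3 : ℕ) ^ m • x = 0)
    {γ₀ : Γ} (hγ : ∀ x : M, (3 : ℕ) • x = 0 → γ₀ • x = -x) (x : M) :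
    γ₀ ^ 3 ^ (m - 1) • x = -x := by
  have key := TorsionLift.pow_three_pow_apply_eq_neg (DistribMulAction.toAddMonoidEnd Γ M γ₀) hm
    hM (fun y hy ↦ by change γ₀ • y = -y; exact hγ y hy) x
  rw [← map_pow] at key
  exact key

/-- **No non-zero fixed vector.** If `3^m M = 0` (`m ≥ 1`) and some `γ₀ ∈ Γ` acts as `−1` on
`M[3]`, then the only `Γ`-fixed element of `M` is `0` (`x = γ₀^{3^{m−1}} • x = −x`, and `2` is
injective on a `3^m`-torsion group). For `M = E[3^m]`, `Γ = Γ_F` with `ρ̄_{E,3}` onto: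
`E(F)[3^m] = 0`-type statements. [folklore] -/
theorem eq_zero_of_forall_smul_eq {m : ℕ} (hm : 1 ≤ m) (hM : ∀ x : M, (3 : ℕ) ^ m • x = 0)
    {γ₀ : Γ} (hγ : ∀ x : M, (3 : ℕ) • x = 0 → γ₀ • x = -x) {x : M} (hfix : ∀ γ : Γ, γ • x = x) :
    x = 0 := by
  have h := smul_pow_three_pow_eq_neg hm hM hγ x
  rw [hfix] at h
  -- `x = -x`
  have h2 : (2 : ℕ) • x = 0 := by rw [two_nsmul]; nth_rw 2 [h]; exact add_neg_cancel x
  exact TorsionLift.eq_zero_of_two_nsmul_eq_zero_of_odd_nsmul_eq_zero (Odd.pow (by decide)) (hM x) h2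

end Action

/-! ### §3. Sah for a subgroup of `Aut(M)` (the shape of `galoisRepTorsion`'s range) -/

section ImageGroup

variable {M : Type*} [AddCommGroup M]

/-- **Every crossed homomorphism of the image group is principal** (Sah's lemma with the central
automorphism `−1`). Let `G ≤ Aut(M)` be a group of additive automorphisms of `M` (e.g. the image of
`Γ_F` in `Aut(E[3^m])` ≅ `Gal(F(E[3^m])/F)`), let some `z ∈ G` act as `−1`, and let `M` be killed by
an odd number `n` (so `2` is invertible on `M`). Then every `f : G → M` with
`f(gh) = g(f h) + f g` is of the form `f g = g a − a`: `H¹(G, M) = 0`. (`z` is central in `G` because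
negation commutes with every additive automorphism; then Sah's computation
`2 f(g) = f(z) − g f(z)`.) The (H.3)-type input "`H¹(F(E[3^m])/F, E[3^m]) = 0`" of Kolyvagin-system
arguments at `p = 3`, abstract form. (`Aut(M)` = Mathlib's `Multiplicative (AddAut M)`, as in
`WeierstrassCurve.galoisRepTorsion`.) [cite: Sah1968, Prop. 2.7 (b) and its proof, p. 60] -/
theorem exists_eq_sub_of_crossedHom_of_neg_mem {n : ℕ} (hn : Odd n) (hM : ∀ x : M, n • x = 0)
    (G : Subgroup (Multiplicative (AddAut M))) {z : Multiplicative (AddAut M)} (hzG : z ∈ G)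
    (hz : ∀ x : M, Multiplicative.toAdd z x = -x) (f : G → M)
    (hf : ∀ g h : G,
      f (g * h) = Multiplicative.toAdd (g : Multiplicative (AddAut M)) (f h) + f g) :
    ∃ a : M, ∀ g : G, f g = Multiplicative.toAdd (g : Multiplicative (AddAut M)) a - a := by
  obtain ⟨k, hk⟩ := hn
  set zG : G := ⟨z, hzG⟩ with hzGdef
  -- `z` is central in `G`
  have hcomm : ∀ g : G, g * zG = zG * g := fun g ↦ by
    apply Subtype.ext
    show (g : Multiplicative (AddAut M)) * z = z * g
    apply Multiplicative.toAdd.injective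
    rw [toAdd_mul, toAdd_mul]
    apply AddEquiv.ext
    intro x
    rw [AddAut.add_apply, AddAut.add_apply, hz, hz, map_neg]
  -- Sah: `f(zg) = z(f g) + f z = -f g + f z`, `f(gz) = g(f z) + f g`
  have key : ∀ g : G,
      f g + f g = f zG - Multiplicative.toAdd (g : Multiplicative (AddAut M)) (f zG) := fun g ↦ by
    have h1 : f (zG * g) = -f g + f zG := by rw [hf]; exact congrArg (· + f zG) (hz _)
    have h2 : f (g * zG) = Multiplicative.toAdd (g : Multiplicative (AddAut M)) (f zG) + f g :=
      hf g zG
    rw [hcomm] at h2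
    have := h1.symm.trans h2
    rw [neg_add_eq_iff_eq_add] at this
    rw [eq_sub_iff_add_eq]
    calc f g + f g + Multiplicative.toAdd (g : Multiplicative (AddAut M)) (f zG)
        = f g + (Multiplicative.toAdd (g : Multiplicative (AddAut M)) (f zG) + f g) := by abel
      _ = f zG := this.symm
  refine ⟨-((k + 1) • f zG), fun g ↦ ?_⟩
  -- compare after doubling (injective on an `n`-torsion group, `n` odd)
  have hinj := (TorsionLift.bijective_two_nsmul_of_odd_nsmul_eq_zero ⟨k, hk⟩ hM).1
  apply hinj
  show (2 : ℕ) • f g = (2 : ℕ) •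
    (Multiplicative.toAdd (g : Multiplicative (AddAut M)) (-((k + 1) • f zG)) - -((k + 1) • f zG))
  have htwo : ∀ y : M, (2 : ℕ) • ((k + 1) • y) = y := fun y ↦ by
    rw [smul_smul, show 2 * (k + 1) = n + 1 by omega, add_nsmul, hM y, one_nsmul, zero_add]
  rw [two_nsmul, key g, smul_sub, map_neg, smul_neg, ← map_nsmul, htwo, smul_neg, htwo]
  abel

/-- **No non-zero fixed vector**: if `x ∈ M` is fixed by an automorphism acting as `−1` and `M` is
killed by an odd number, then `x = 0`. [folklore] -/
theorem eq_zero_of_toAdd_apply_eq {n : ℕ} (hn : Odd n) (hM : ∀ x : M, n • x = 0)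
    {z : Multiplicative (AddAut M)} (hz : ∀ x : M, Multiplicative.toAdd z x = -x) {x : M}
    (hfix : Multiplicative.toAdd z x = x) : x = 0 := by
  rw [hz] at hfix
  have h2 : (2 : ℕ) • x = 0 := by rw [two_nsmul]; nth_rw 1 [← hfix]; exact neg_add_cancel x
  exact TorsionLift.eq_zero_of_two_nsmul_eq_zero_of_odd_nsmul_eq_zero hn (hM x) h2

end ImageGroup

/-! ### §4. The range of an action `Γ → Aut(M)`: lift + Sah assembled (the consumer shape) -/

section Range

variable {Γ M : Type*} [Group Γ] [AddCommGroup M] [DistribMulAction Γ M]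

/-- `DistribMulAction.toAddAut` is the action: `toAdd (toAddAut Γ M γ) x = γ • x`. [folklore] -/
theorem toAdd_toAddAut_apply (γ : Γ) (x : M) :
    Multiplicative.toAdd (DistribMulAction.toAddAut Γ M γ) x = γ • x := rfl

/-- **`H¹(image, M) = 0` — the consumer shape.** Let `Γ` act on the additive group `M` with
`3^m M = 0` (`m ≥ 1`), and suppose SOME `γ₀ ∈ Γ` acts as `−1` on `M[3]`. Let
`R = (DistribMulAction.toAddAut Γ M).range ≤ Aut(M)` be the image of the action (for `Γ = Γ_F`,
`M = E[3^m]`, `toAddAut = galoisRepTorsion`: `R ≅ Gal(F(E[3^m])/F)`, and `γ₀` comes from `ρ̄_{E,3}`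
onto). Then every crossed homomorphism `f : R → M` (`f(gh) = g(f h) + f g`) is principal:
"`H¹(F(E[3^m])/F, E[3^m]) = 0`"-type vanishing at `p = 3` from mod-`3` information alone (lift §2 +
Sah §3). [cite: Sah1968, Prop. 2.7 (b) and its proof, p. 60] [cite: LawsonWuthrich2016, Lemma 3] -/
theorem range_toAddAut_exists_eq_sub_of_crossedHom {m : ℕ} (hm : 1 ≤ m)
    (hM : ∀ x : M, (3 : ℕ) ^ m • x = 0) {γ₀ : Γ} (hγ : ∀ x : M, (3 : ℕ) • x = 0 → γ₀ • x = -x)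
    (f : (DistribMulAction.toAddAut Γ M).range → M)
    (hf : ∀ g h : (DistribMulAction.toAddAut Γ M).range,
      f (g * h) = Multiplicative.toAdd (g : Multiplicative (AddAut M)) (f h) + f g) :
    ∃ a : M, ∀ g : (DistribMulAction.toAddAut Γ M).range,
      f g = Multiplicative.toAdd (g : Multiplicative (AddAut M)) a - a :=
  exists_eq_sub_of_crossedHom_of_neg_mem (Odd.pow (by decide) : Odd (3 ^ m)) hM
    (DistribMulAction.toAddAut Γ M).range (z := DistribMulAction.toAddAut Γ M (γ₀ ^ 3 ^ (m - 1)))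
    ⟨_, rfl⟩ (fun x ↦ by rw [toAdd_toAddAut_apply]; exact smul_pow_three_pow_eq_neg hm hM hγ x) f hf

/-- **No non-zero `Γ`-fixed vector** (same hypotheses): `M^Γ = 0`, i.e. "`E(F)[3^m] = 0` as soon as
`ρ̄_{E,3}` hits `−1`" in the application (= `eq_zero_of_forall_smul_eq`, recorded next to the `H¹`
statement for the consumer). [folklore] -/
theorem range_toAddAut_eq_zero_of_forall_smul_eq {m : ℕ} (hm : 1 ≤ m)
    (hM : ∀ x : M, (3 : ℕ) ^ m • x = 0) {γ₀ : Γ} (hγ : ∀ x : M, (3 : ℕ) • x = 0 → γ₀ • x = -x)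
    {x : M} (hfix : ∀ γ : Γ, γ • x = x) : x = 0 :=
  eq_zero_of_forall_smul_eq hm hM hγ hfix

end Range

end Summit.BirchSwinnertonDyer.Rank1Residual.X11b.Three
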